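import Literature.MathematicalPhysics.QuantumLattice.HeatKernelGroup
import Mathlib.MeasureTheory.Integral.Bochner.Basic
import HarnessLib

/-!
# Route `WilsonVillainDualStiffness` / `WilsonVillainPerimeterTransfer`, shared crux stmt-QuantumFields-26809
# `HartmanWatsonMixture`: the ONE route-posited object of its registered line — the witness-arc heat-kernel mass `arcMass`

D-0016 `<Route><Piece>Defs` file (an object the crux's LINE posits; reviewed; nothing asserted).  The registered BC3
skeleton v2 of the shared crux `HartmanWatsonMixture` (planner `ym-idea-3` g6, `Lines`/birth file
`HartmanWatsonMixture_birth_v2.lean`, sha256 a1776bf4…; stubs `stub_mixingMeasureExists` [named fact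
Hartman–Watson 1974], `stub_arcMassLowerBound` [S–M], `stub_tailFromArcBound` [M]) proves the hot-set tail of the
Hartman–Watson mixing measure by a ONE-PARAMETER DUAL WITNESS `u = 1 − A·1_J` on the circle, where `J` is the arc
`{θ : θ₀ − δ ≤ |θ| ≤ θ₀ + δ}` with `θ₀ = 2.13`, `δ = 0.05` (i.e. `104/50 ≤ |θ| ≤ 109/50`), and the quantity both
analysis stubs talk about is the heat-kernel mass of that arc,

  `arcMass t = P_t(J) = (1/2π) ∫_{[-π, π]} 1_J(θ) · p_t(e^{iθ}) dθ`,

`p_t = circleHeatKernel t` (tree `Literature/MathematicalPhysics/QuantumLattice/HeatKernelGroup.lean`: the heat kernel of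
`U(1)` for `½ d²/dθ²`, a density w.r.t. `dθ/2π`).  This file holds that definition CHARACTER-IDENTICAL to the skeleton's
local `arcMass` (so the registered stub signatures `… ≤ arcMass t` elaborate against it by name from both the skeleton's
namespace `…Cruxes.HartmanWatsonMixture.Birth` and the stub files' namespaces below `…Cruxes.HartmanWatsonMixture`), plus
its unfolding lemma.  Nothing about the Hartman–Watson law, the crux, the routes' nodes (`U1HelicityGapTorusD4`,
`AbelianDeconfinementD4`) or any summit statement is asserted here.  Seat `ym-line-frs-p2` g9 (free hands, announced on
the owner's bus), `--supports stmt-QuantumFields-26809`.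

References: P. Hartman, G. S. Watson, Ann. Probab. 2 (1974) 593–607 (the mixing law); E. M. Stein, *Topics in Harmonic
Analysis* (1970), Ch. II §2 (the circle heat kernel).
-/

noncomputable section

namespace Summit.QuantumFields.YangMills.Cruxes.HartmanWatsonMixture

/-- **The witness-arc heat-kernel mass** `P_t(J) = (1/2π) ∫_{[-π,π]} 1_J(θ) p_t(e^{iθ}) dθ` of the arc
`J = {θ : 104/50 ≤ |θ| ≤ 109/50}` (`θ₀ = 2.13`, `δ = 0.05`; `|J| = 4δ = 1/5`) under the circle heat kernel
`p_t = circleHeatKernel t` (density w.r.t. `dθ/2π`).  CHARACTER-IDENTICAL to the local `arcMass` of the registered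
skeleton `HartmanWatsonMixture_birth_v2.lean` of crux stmt-QuantumFields-26809. [problem-side definition] -/
def arcMass (t : ℝ) : ℝ :=
  (∫ θ in Set.Icc (-Real.pi) Real.pi,
      (if (104 / 50 : ℝ) ≤ |θ| ∧ |θ| ≤ 109 / 50 then (1 : ℝ) else 0) *
        Literature.MathematicalPhysics.QuantumLattice.circleHeatKernel t (Circle.exp θ)) / (2 * Real.pi)

/-- Unfolding `arcMass`. -/
theorem arcMass_def (t : ℝ) :
    arcMass t = (∫ θ in Set.Icc (-Real.pi) Real.pi,
      (if (104 / 50 : ℝ) ≤ |θ| ∧ |θ| ≤ 109 / 50 then (1 : ℝ) else 0) *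
        Literature.MathematicalPhysics.QuantumLattice.circleHeatKernel t (Circle.exp θ)) / (2 * Real.pi) :=
  rfl

end Summit.QuantumFields.YangMills.Cruxes.HartmanWatsonMixture

end
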